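import Summits.KontsevichZagierPeriods.KontsevichZagierPeriods.Theorems.LinRedNormalFormArrangementNormalFormStubRebaseSimpleZeroNestedDiffE1VertexWedge

/-!
# Stub `stub_rebaseSimpleZeroTwo`, part `rebaseSimpleZero_HDiff1_of_HPar1` (crux
`ArrangementNormalForm`, line `janus-bands`) — brick `NestedDiffE1VertexOuter`

**A pinch vertex carrying the OUTER letter.** A datum of the interval normal form `HDiff₁`
(`RebaseE1.IsDN`, base constant `K ≠ 0`) which pinches at the left end, `A(l) = B(l) = t₀`, whose
outer letter passes through the vertex (`cⱼ(l) = t₀`) while the inner letter and the base pole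
stay off it (`cᵢ ≠ t₀`, pole off `[l, u]`), and whose right end is regular, is good for `GG 0 2 2`
given `HPar1` (`IsDN.good_vtx_outer`, registered as `rebaseSimpleZero_E1vertexOuter`). After the
base cut at an explicit mesh `l + δ` (the right piece is regular, `IsDN.good_middle`):
* `λ > B'`: brick `NestedDiffE1VertexWedge` (`IsDN.good_vtx_outer_above`);
* `λ < A'` (`IsDN.good_vtx_outer_below`): super-section Janus at `cⱼ + η/2` (`IsDN.good_sup`,
  `η = |cᵢ − t₀|`); `tⱼ − cⱼ ≥ tᵢ − cⱼ = (tᵢ − A) + (A' − λ)(y − l)`, wedge estimate in the frame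
  `(tⱼ, tᵢ − A' y, y)`;
* `λ = A'`, i.e. `A ≡ cⱼ` (`IsDN.good_vtx_outer_bottom`): super-section Janus at `A + η/2`;
  `tⱼ − A ≥ √((tᵢ − A)(tⱼ − A))`, wedge in the frame `(y, tᵢ − A' y, tⱼ − A' y)`.
(`A' < λ < B'` is excluded by the side of the outer letter, `λ = B'` is `HPar1`.)

References: M. Kontsevich, D. Zagier, *Periods* (2001), §1.2, rules (1a), (2).
-/

noncomputable section

open Set MeasureTheory MvPolynomial
open Literature.NumberTheory.Transcendental Literature.ModelTheory.ExponentialFields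

namespace Summit.KontsevichZagierPeriods.ArrangementNormalForm.JanusBands

namespace RebaseE1

open SeparatePos RebasePos RebaseZero RebaseNest RebaseDiff

variable {i j : Fin 2} {s : KZ.IntegralRep (0 + 1 + 2)} {l u : ℚ} {A B : Cf} {T : BData}
  {p : MvPolynomial (Fin 0) ℚ} {a : Fin 2 → Option Cf} {ci cj : Cf}

/-! ### The outer letter through the vertex from below -/

/-- **Outer letter through the vertex, `λ < A'`.** Super-section Janus at `cⱼ + η/2` after the
base cut; the box converges by the wedge estimate in the frame `(tⱼ, tᵢ − A' y, y)`.
[Kontsevich–Zagier 2001, §1.2, rules (1a), (2)] -/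
theorem IsDN.good_vtx_outer_below (h : IsDN s l u A B T p a i j) (hL : LData T a i j ci cj)
    (hP : HParS T p a i j ci cj) (hK : Kc T p ≠ 0) (hpinch : evq A l = evq B l)
    (hcj : evq cj l = evq A l) (hci : ci.2 ≠ evq A l) (hlam : cj.1 (Fin.last 0) < A.1 (Fin.last 0))
    (hreg : evq A u < evq B u) (hr : T.ℓ₂.2 < l ∨ u < T.ℓ₂.2) : Good 2 (KZ.of s) := by
  have hij := h.ne
  have hadm : T.n₁ = 0 ∨ T.n₂ = 0 := Or.inl hL.n1
  -- constants
  set t₀ : ℚ := evq A l with ht₀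
  set α : ℚ := A.1 (Fin.last 0) with hα
  set β : ℚ := B.1 (Fin.last 0) with hβ
  set lam : ℚ := cj.1 (Fin.last 0) with hlamdef
  set η : ℚ := |ci.2 - t₀| with hη
  have hη0 : 0 < η := abs_pos.2 (sub_ne_zero.2 hci)
  obtain ⟨δ, hδ0, hqu, hαδ, hβδ, hlamδ⟩ := exists_mesh h.lu α β lam hη0
  have hlq : l < l + δ := by linarith
  -- cut at `l + δ`; the right piece is regular
  refine h.good_split (l + δ) hlq hqu (fun s₁ h₁ => ?_) fun s₂ h₂ =>
    h₂.good_middle hL hP hK (h.evq_lt hlq hqu) hreg (hr.imp_left fun hr' => hr'.trans hlq)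
  -- real bookkeeping
  have hη0R : (0 : ℝ) < η := by exact_mod_cast hη0
  have hηR : (η : ℝ) = |(ci.2 : ℝ) - t₀| := by rw [hη, Rat.cast_abs, Rat.cast_sub]
  have hαδR : |(α : ℝ)| * δ ≤ η / 8 := by rw [← Rat.cast_abs]; exact_mod_cast hαδ
  have hβδR : |(β : ℝ)| * δ ≤ η / 8 := by rw [← Rat.cast_abs]; exact_mod_cast hβδ
  have hlamδR : |(lam : ℝ)| * δ ≤ η / 8 := by rw [← Rat.cast_abs]; exact_mod_cast hlamδ
  have hκ : (0 : ℝ) < α - lam := by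
    have h' : lam < α := hlam
    have h'' : (lam : ℝ) < α := by exact_mod_cast h'
    linarith
  have hA : ∀ y : ℝ, ev A y = t₀ + α * (y - l) := fun y => by rw [ev_pinch A l]
  have hAv : ∀ y : ℝ, ev A y = α * y + A.2 := fun y => by rw [ev]
  have hB : ∀ y : ℝ, ev B y = t₀ + β * (y - l) := fun y => by rw [ev_pinch B l, ← hpinch]
  have hC : ∀ y : ℝ, ev cj y = t₀ + lam * (y - l) := fun y => by rw [ev_pinch cj l, hcj]
  -- the section
  set Z : Cf := RebaseZero.mk lam (t₀ - lam * l + η / 2) with hZ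
  have hZv : ∀ y : ℝ, ev Z y = t₀ + η / 2 + lam * (y - l) := fun y => by rw [hZ, ev_mk]; push_cast; ring
  have hBZ : ∀ y : ℝ, (l : ℝ) < y → y < ((l + δ : ℚ) : ℝ) → ev B y < ev Z y := fun y h1 h2 => by
    push_cast at h2
    rw [hZv, hB]
    have := (abs_le.1 (abs_slope_mul_le hβδR h1 h2)).2
    have := (abs_le.1 (abs_slope_mul_le hlamδR h1 h2)).1
    linarith
  -- pole margin
  obtain ⟨ρ, hρ, hρle⟩ := pole_margin hr hqu.le
  -- the box converges
  have hWW : IntegrableOn (glitB T p a)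
      (gDom 0 2 2 ![RebaseZero.mk 1 (-l), RebaseZero.mk (-1) (l + δ)] (nlo i A) (nhi j Z)) := by
    refine integrableOn_of_wedge (isSemialgebraic_gDom _ _ _ _) (isBounded_nDom_Ioo hij l (l + δ) _ _)
      (isSemialgebraicFunOn_glit (isSemialgebraic_gDom _ _ _ _) _ _ _ _ _ _ _ _) (wLinY i j (α : ℝ))
      (wLinY_det_ne hij _) (A.2 : ℝ) (l : ℝ) (|Kc T p| * (1 / (2 * Real.sqrt (α - lam))) / (ρ * (3 * η / 8)))
      fun z hz hz1 hz2 => ?_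
    obtain ⟨-, e1, e2⟩ := wLinY_apply i j (α : ℝ) z
    rw [e1] at hz1 ⊢
    rw [e2] at hz2 ⊢
    rw [mem_nDom_Ioo hij] at hz
    obtain ⟨⟨hy1, hy2⟩, h3, h4, h5⟩ := hz
    have hY : ρ ≤ |yv z - T.ℓ₂.2| := hρle _ hy1 hy2
    push_cast at hy2
    rw [hZv] at h5
    -- the three factors
    have hαy := abs_le.1 (abs_slope_mul_le hαδR hy1 hy2)
    have hlamy := abs_le.1 (abs_slope_mul_le hlamδR hy1 hy2)
    have hAt : t₀ - η / 8 < tv z i := by rw [hA] at h3; linarith [hαy.1]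
    have hgi : 3 * (η : ℝ) / 8 ≤ |tv z i - ev ci (yv z)| := by
      rw [ev_of_fst_eq_zero hL.ci0]
      exact inner_margin hηR (by linarith) (by linarith [hlamy.2])
    have hPpos : 0 < tv z i - ev cj (yv z) := by
      have : ev cj (yv z) < ev A (yv z) := by rw [hC, hA]; nlinarith
      linarith
    have hQpos : 0 < tv z j - ev cj (yv z) := by linarith
    have hL1 : |tv z i - α * yv z - A.2| = tv z i - ev A (yv z) := by
      rw [hAv, abs_of_pos (by rw [hAv] at h3; linarith)]; ring
    have hL2 : |yv z - l| = yv z - l := abs_of_pos (by linarith)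
    have hsq : Real.sqrt |tv z i - α * yv z - A.2| * Real.sqrt |yv z - l| ≤
        (1 / (2 * Real.sqrt (α - lam))) * (tv z j - ev cj (yv z)) := by
      rw [hL1, hL2, mul_comm]
      have key := sqrt_mul_sqrt_le_weighted hκ (by linarith : (0 : ℝ) ≤ yv z - l)
        (by linarith : (0 : ℝ) ≤ tv z i - ev A (yv z))
      have e : (α - lam : ℝ) * (yv z - l) + (tv z i - ev A (yv z)) = tv z i - ev cj (yv z) := by
        rw [hA, hC]; ring
      rw [e] at key
      have hs : 0 < 2 * Real.sqrt (α - lam) := by positivity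
      calc Real.sqrt (yv z - l) * Real.sqrt (tv z i - ev A (yv z))
          ≤ (tv z i - ev cj (yv z)) / (2 * Real.sqrt (α - lam)) := key
        _ ≤ (tv z j - ev cj (yv z)) / (2 * Real.sqrt (α - lam)) := by
            rw [div_le_div_iff_of_pos_right hs]; linarith
        _ = (1 / (2 * Real.sqrt (α - lam))) * (tv z j - ev cj (yv z)) := by ring
    have hgj : 1 / |tv z j - ev cj (yv z)| ≤ (1 / (2 * Real.sqrt (α - lam))) /
        (Real.sqrt |tv z i - α * yv z - A.2| * Real.sqrt |yv z - l|) := by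
      rw [abs_of_pos hQpos]
      exact one_div_le_sqrt hQpos (sub_ne_zero.2 hz1) (sub_ne_zero.2 hz2) hsq
    have hS : 0 < Real.sqrt |tv z i - α * yv z - A.2| * Real.sqrt |yv z - l| :=
      mul_pos (Real.sqrt_pos.2 (abs_pos.2 (sub_ne_zero.2 hz1))) (Real.sqrt_pos.2 (abs_pos.2 (sub_ne_zero.2 hz2)))
    rw [abs_glitB hL p z]
    refine wedge_bound hρ (by positivity) hS hY ?_
    exact mul_le_mul (one_div_le_one_div_of_le (by positivity) hgi) hgj (by positivity) (by positivity)
  have fT : Z.1 (Fin.last 0) = cj.1 (Fin.last 0) := by rw [hZ, mk_fst]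
  exact h₁.good_sup hadm Z hBZ hWW (fun W hW' => hW'.good_par hP (Or.inr fT)) fun r₃ hr₃ =>
    hr₃.good_par hP (Or.inr fT)

/-! ### The outer letter is the bottom -/

/-- **Outer letter through the vertex, `λ = A'` (`A ≡ cⱼ`).** Super-section Janus at `A + η/2`
after the base cut; the box converges by the wedge estimate in the frame
`(y, tᵢ − A' y, tⱼ − A' y)` (`tⱼ − A ≥ √((tᵢ − A)(tⱼ − A))`). [Kontsevich–Zagier 2001, §1.2] -/
theorem IsDN.good_vtx_outer_bottom (h : IsDN s l u A B T p a i j) (hL : LData T a i j ci cj)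
    (hP : HParS T p a i j ci cj) (hK : Kc T p ≠ 0) (hpinch : evq A l = evq B l)
    (hcj : evq cj l = evq A l) (hci : ci.2 ≠ evq A l) (hlam : cj.1 (Fin.last 0) = A.1 (Fin.last 0))
    (hreg : evq A u < evq B u) (hr : T.ℓ₂.2 < l ∨ u < T.ℓ₂.2) : Good 2 (KZ.of s) := by
  have hij := h.ne
  have hadm : T.n₁ = 0 ∨ T.n₂ = 0 := Or.inl hL.n1
  -- constants
  set t₀ : ℚ := evq A l with ht₀
  set α : ℚ := A.1 (Fin.last 0) with hα
  set β : ℚ := B.1 (Fin.last 0) with hβ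
  set η : ℚ := |ci.2 - t₀| with hη
  have hη0 : 0 < η := abs_pos.2 (sub_ne_zero.2 hci)
  obtain ⟨δ, hδ0, hqu, hαδ, hβδ, -⟩ := exists_mesh h.lu α β 0 hη0
  have hlq : l < l + δ := by linarith
  -- cut at `l + δ`; the right piece is regular
  refine h.good_split (l + δ) hlq hqu (fun s₁ h₁ => ?_) fun s₂ h₂ =>
    h₂.good_middle hL hP hK (h.evq_lt hlq hqu) hreg (hr.imp_left fun hr' => hr'.trans hlq)
  -- real bookkeeping
  have hη0R : (0 : ℝ) < η := by exact_mod_cast hη0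
  have hηR : (η : ℝ) = |(ci.2 : ℝ) - t₀| := by rw [hη, Rat.cast_abs, Rat.cast_sub]
  have hαδR : |(α : ℝ)| * δ ≤ η / 8 := by rw [← Rat.cast_abs]; exact_mod_cast hαδ
  have hβδR : |(β : ℝ)| * δ ≤ η / 8 := by rw [← Rat.cast_abs]; exact_mod_cast hβδ
  have hA : ∀ y : ℝ, ev A y = t₀ + α * (y - l) := fun y => by rw [ev_pinch A l]
  have hAv : ∀ y : ℝ, ev A y = α * y + A.2 := fun y => by rw [ev]
  have hB : ∀ y : ℝ, ev B y = t₀ + β * (y - l) := fun y => by rw [ev_pinch B l, ← hpinch]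
  have hC : ∀ y : ℝ, ev cj y = ev A y := fun y => by rw [ev_pinch cj l, hcj, hlam, ← hA]
  -- the section
  set Z : Cf := RebaseZero.mk α (A.2 + η / 2) with hZ
  have hZv : ∀ y : ℝ, ev Z y = ev A y + η / 2 := fun y => by rw [hZ, ev_mk, hAv]; push_cast; ring
  have hBZ : ∀ y : ℝ, (l : ℝ) < y → y < ((l + δ : ℚ) : ℝ) → ev B y < ev Z y := fun y h1 h2 => by
    push_cast at h2
    rw [hZv, hB, hA]
    have := (abs_le.1 (abs_slope_mul_le hβδR h1 h2)).2
    have := (abs_le.1 (abs_slope_mul_le hαδR h1 h2)).1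
    linarith
  -- pole margin
  obtain ⟨ρ, hρ, hρle⟩ := pole_margin hr hqu.le
  -- the box converges
  have hWW : IntegrableOn (glitB T p a)
      (gDom 0 2 2 ![RebaseZero.mk 1 (-l), RebaseZero.mk (-1) (l + δ)] (nlo i A) (nhi j Z)) := by
    refine integrableOn_of_wedge (isSemialgebraic_gDom _ _ _ _) (isBounded_nDom_Ioo hij l (l + δ) _ _)
      (isSemialgebraicFunOn_glit (isSemialgebraic_gDom _ _ _ _) _ _ _ _ _ _ _ _) (wLinT i j (α : ℝ))
      (wLinT_det_ne hij _) (A.2 : ℝ) (A.2 : ℝ) (|Kc T p| * 1 / (ρ * (3 * η / 8)))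
      fun z hz hz1 hz2 => ?_
    obtain ⟨-, e1, e2⟩ := wLinT_apply i j (α : ℝ) z
    rw [e1] at hz1 ⊢
    rw [e2] at hz2 ⊢
    rw [mem_nDom_Ioo hij] at hz
    obtain ⟨⟨hy1, hy2⟩, h3, h4, h5⟩ := hz
    have hY : ρ ≤ |yv z - T.ℓ₂.2| := hρle _ hy1 hy2
    push_cast at hy2
    rw [hZv] at h5
    -- the three factors
    have hαy := abs_le.1 (abs_slope_mul_le hαδR hy1 hy2)
    have hgi : 3 * (η : ℝ) / 8 ≤ |tv z i - ev ci (yv z)| := by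
      rw [ev_of_fst_eq_zero hL.ci0]
      have := hA (yv z)
      exact inner_margin hηR (by linarith [hαy.1]) (by linarith [hαy.2])
    have hQpos : 0 < tv z j - ev cj (yv z) := by rw [hC]; linarith
    have hL1 : |tv z i - α * yv z - A.2| = tv z i - ev A (yv z) := by
      rw [hAv, abs_of_pos (by rw [hAv] at h3; linarith)]; ring
    have hL2 : |tv z j - α * yv z - A.2| = tv z j - ev A (yv z) := by
      rw [hAv, abs_of_pos (by rw [hAv] at h3; linarith)]; ring
    have hsq : Real.sqrt |tv z i - α * yv z - A.2| * Real.sqrt |tv z j - α * yv z - A.2| ≤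
        1 * (tv z j - ev cj (yv z)) := by
      rw [hL1, hL2, hC, one_mul]
      exact sqrt_mul_sqrt_le_of_le (by linarith) (by linarith)
    have hgj : 1 / |tv z j - ev cj (yv z)| ≤ 1 /
        (Real.sqrt |tv z i - α * yv z - A.2| * Real.sqrt |tv z j - α * yv z - A.2|) := by
      rw [abs_of_pos hQpos]
      exact one_div_le_sqrt hQpos (sub_ne_zero.2 hz1) (sub_ne_zero.2 hz2) hsq
    have hS : 0 < Real.sqrt |tv z i - α * yv z - A.2| * Real.sqrt |tv z j - α * yv z - A.2| :=
      mul_pos (Real.sqrt_pos.2 (abs_pos.2 (sub_ne_zero.2 hz1))) (Real.sqrt_pos.2 (abs_pos.2 (sub_ne_zero.2 hz2)))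
    rw [abs_glitB hL p z]
    refine wedge_bound hρ (by positivity) hS hY ?_
    exact mul_le_mul (one_div_le_one_div_of_le (by positivity) hgi) hgj (by positivity) (by positivity)
  have fT : Z.1 (Fin.last 0) = cj.1 (Fin.last 0) := by rw [hZ, mk_fst, hlam]
  exact h₁.good_sup hadm Z hBZ hWW (fun W hW' => hW'.good_par hP (Or.inr fT)) fun r₃ hr₃ =>
    hr₃.good_par hP (Or.inr fT)

/-! ### The driver -/

/-- **A pinch vertex carrying the outer letter only** (pole and inner letter off the vertex,
regular right end) is good given `HPar1`: by the side of the outer letter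
(`IsDN.outer_side`), `λ ≤ A'` (`good_vtx_outer_below` / `good_vtx_outer_bottom`) or `λ ≥ B'`
(`λ = B'` is `HPar1`, else `good_vtx_outer_above`). [Kontsevich–Zagier 2001, §1.2] -/
theorem IsDN.good_vtx_outer (h : IsDN s l u A B T p a i j) (hL : LData T a i j ci cj)
    (hP : HParS T p a i j ci cj) (hK : Kc T p ≠ 0) (hpinch : evq A l = evq B l)
    (hcj : evq cj l = evq A l) (hci : ci.2 ≠ evq A l) (hreg : evq A u < evq B u)
    (hr : T.ℓ₂.2 < l ∨ u < T.ℓ₂.2) : Good 2 (KZ.of s) := by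
  have hlu : (l : ℝ) < u := by exact_mod_cast h.lu
  have hm1 : (l : ℝ) < ((l : ℝ) + u) / 2 := by linarith
  have hm2 : ((l : ℝ) + u) / 2 < u := by linarith
  rcases lt_trichotomy (cj.1 (Fin.last 0)) (A.1 (Fin.last 0)) with hlt | heq | hgt
  · exact h.good_vtx_outer_below hL hP hK hpinch hcj hci hlt hreg hr
  · exact h.good_vtx_outer_bottom hL hP hK hpinch hcj hci heq hreg hr
  rcases h.outer_side hL hK with hlo | hhi
  · exfalso
    have key := hlo _ hm1 hm2
    rw [ev_pinch cj l, ev_pinch A l, hcj] at key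
    have hgt' : (A.1 (Fin.last 0) : ℝ) < cj.1 (Fin.last 0) := by exact_mod_cast hgt
    nlinarith
  · have key := hhi _ hm1 hm2
    rw [ev_pinch cj l, ev_pinch B l, hcj, hpinch] at key
    have hge : (B.1 (Fin.last 0) : ℝ) ≤ cj.1 (Fin.last 0) := by nlinarith
    rcases hge.lt_or_eq with hlt' | heq'
    · exact h.good_vtx_outer_above hL hP hK hpinch hcj hci (by exact_mod_cast hlt') hreg hr
    · exact h.good_par hP (Or.inr (by exact_mod_cast heq'))

end RebaseE1

/-- **Registered brick `rebaseSimpleZero_E1vertexOuter`** (part `rebaseSimpleZero_HDiff1_of_HPar1` of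
`stub_rebaseSimpleZeroTwo`, line `janus-bands`): a datum of the interval normal form `HDiff₁`
(`RebaseE1.IsDN`) with non-zero base constant which pinches at the left end, whose OUTER letter
passes through the pinch vertex while the inner letter and the base pole stay off it, and whose
right end is regular, is congruent modulo `KZ.relations` to the subgroup generated by `GG 0 2 2`,
given `HPar1` (`RebaseE1.IsDN.good_vtx_outer`: base cut at an explicit mesh, then one sub- or
super-section Janus whose box converges by the wedge estimate). [Kontsevich–Zagier 2001, §1.2] -/
theorem rebaseSimpleZero_E1vertexOuter (i j : Fin 2) (s : KZ.IntegralRep (0 + 1 + 2)) (l u : ℚ) (A B ci cj : (Fin (0 + 1) → ℚ) × ℚ) (T : RebaseZero.BData) (p : MvPolynomial (Fin 0) ℚ) (a : Fin 2 → Option ((Fin (0 + 1) → ℚ) × ℚ)) (h : RebaseE1.IsDN s l u A B T p a i j) (hL : RebaseE1.LData T a i j ci cj) (hP : RebaseE1.HParS T p a i j ci cj) (hK : RebaseDiff.Kc T p ≠ 0) (hpinch : RebaseE1.evq A l = RebaseE1.evq B l) (hcj : RebaseE1.evq cj l = RebaseE1.evq A l) (hci : ci.2 ≠ RebaseE1.evq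 A l) (hreg : RebaseE1.evq A u < RebaseE1.evq B u) (hr : T.ℓ₂.2 < l ∨ u < T.ℓ₂.2) : RebaseZero.Good 2 (KZ.of s) :=
  h.good_vtx_outer hL hP hK hpinch hcj hci hreg hr

end Summit.KontsevichZagierPeriods.ArrangementNormalForm.JanusBands
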